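import Mathlib
import HarnessLib
import HarnessLib.Audit
import Summits.MatrixMultiplication.Statement
import Literature.Computability.AlgebraicComplexity.GroupAlgebraTensor
import Literature.Computability.AlgebraicComplexity.AsymptoticSumInequality
import HarnessLib.Audit.Status.Attr

/-!
Route: SemilatticeSTPP

DORMANT since 2026-08-26T12:04:41Z (reconciler: no traction for 8.3 d (last activity item-evidence-added at 2026-08-18T04:21:54Z); parked, not closed — `ledger route dormant route-MatrixMultiplication-SemilatticeSTPP --off` to reactivat) — unstaffed, not closed; items shared with open routes are served there. `ledger route dormant <id> --off` reactivates.

# Route SemilatticeSTPP — monomial STPP packings in semilattice and Clifford-monoid tables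
(Moebius-diagonal hosts)

X_M ("it suffices to show"; realises card semilattice-stpp-moebius-hosts): for every ε > 0 there is
a finite commutative
monoid M in which every element is regular (x = xyx — a Clifford monoid = semilattice of abelian
groups: pure semilattices,
abelian groups, (Z/N,×) with N squarefree, subspace lattices …) and a MONOID-TPP family — coordinate
maps α_i : [a_i]×[b_i] → M,
β_i : [b_i]×[c_i] → M, γ_i : [a_i]×[c_i] → M with α_i(s,t)·β_j(t',u) = γ_k(s',u') ⟺ (i=j=k, t=t',
s=s', u=u'), i.e. a zeroing-out
of the multiplication-table tensor T_M = groupTensor ℂ M onto ⊕_i ⟨a_i,b_i,c_i⟩ = matMulDirectSum —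
with |M| < Σ_i (a_i b_i c_i)^((2+ε)/3).
Because ℂ[M] ≅ ℂ^|M| (Moebius inversion / Munn–Ponizovskii), R(T_M) ≤ |M| with no character-degree
loss, so X_M ⇒ ω(ℂ) ≤ 2+ε for all ε.
X_C of route GroupTheoreticSTPP (abelian groups) implies X_M; the NEW freedom, and every crux below,
lives in the idempotent part:
products of non-matching pairs are pushed strictly UP in the order and garbage is separated by
order, not by cancellation-freeness.
Lean: `∀ ε : ℝ, 0 < ε → ∃ (M : Type) (_ : CommMonoid M) (_ : Fintype M), (∀ x : M, ∃ y : M, x * y *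
x = x) ∧ ∃ (p : ℕ) (a b c : Fin p → ℕ) (α : (Σ i, Fin (a i) × Fin (b i)) → M) (β : (Σ i, Fin (b i) ×
Fin (c i)) → M) (γ : (Σ i, Fin (a i) × Fin (c i)) → M), (∀ x y z, α x * β y = γ z ↔ (z.1 = x.1 ∧ x.1
= y.1 ∧ (z.2.1 : ℕ) = x.2.1 ∧ (x.2.2 : ℕ) = y.2.1 ∧ (z.2.2 : ℕ) = y.2.2)) ∧ (Fintype.card M : ℝ) < ∑
i, ((a i * b i * c i : ℕ) : ℝ) ^ ((2 + ε) / 3)`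

## Assembly
Bookkeeping over the proved cone (sorry-free in Sketch.lean, axioms propext/choice/Quot.sound): if
ω(ℂ) > 2 take ε = ω − 2 in the
Thesis; TPPRestriction gives matMulDirectSum ℂ a b c ≤ groupTensor ℂ M, RegularMonoidRank and
TensorRestrictsTo.tensorRank_le give
R(⊕⟨a_i,b_i,c_i⟩) ≤ |M|, asymptoticSumInequality_rank (Blaser2013 Thm 7.5 for rank, PROVED) gives Σ
(a_i b_i c_i)^(ω/3) ≤ |M| <
Σ (a_i b_i c_i)^((2+ε)/3) = Σ (a_i b_i c_i)^(ω/3), contradiction; ω ≥ 2 is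
Literature.CplxAlg.two_le_omega (Theorems/AsymptoticSpectrumOmegaGeTwo).
IdempotentPacking → Thesis and IdempotentPacking → IdempotentVolumeBeat are also proved in
Sketch.lean.

Rationale: WHY THIS LINE. Mechanism (card semilattice-stpp-moebius-hosts): replace the host GROUP of
CohnUmans2003 / CohnKleinbergSzegedyUmans2005 by a finite
commutative inverse monoid, the one class of finite monoids whose table tensor is a unit tensor
⟨|M|⟩ in disguise (Solomon1967 for
semilattices, Steinberg2016 Ch. 9 for inverse monoids), and pack many matrix products MONOMIALLY
into the table; the assembly
(restriction ⇒ rank ≤ |M| ⇒ Schoenhage's asymptotic sum inequality, PROVED in tree as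
asymptoticSumInequality_rank) is sorry-free in
Sketch.lean. In the language of AlmanVassilevskaWilliams2018 (arXiv:1810.08671 §3) this is the Solar
method (zeroing-outs of powers)
on T_M; their only limitation tools do not start here: every nontrivial finite group has asymptotic
independence number Ĩ(T_G) < |G|
and hence ω_g(T_G) > 2 (Cor 6.1 / Thm 6.1, via Sawin2018), whereas the 2-element semilattice already
has Ĩ(T_OR) = R̃(T_OR) = 2
(middle-layer matching (A,A,A), |A| = m/2, in (2^[m],∪)), so T_OR^⊗m is not even a monomial
degeneration of a group tensor of order
≤ 2^m, slice rank of T_M is full in every characteristic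
(BlasiakChurchCohnGrochowNaslundSawinUmans2017's engine is toothless), and
the support functionals of the OR support are maximal; linear embeddings into diagonal algebras are
tautological (YeLim2016 Thm 5.2),
monomial ones are not. Imported areas: semigroup representation theory (Moebius diagonalisation),
extremal set theory (single blocks
are classified by a core K_i plus Bollobas1965 cross-intersecting set-pair systems; every finite
semilattice is a union-closed set
family via x ↦ {y : y ≱ x}, so all idempotent hosts are sub-semilattices of Boolean lattices),
additive combinatorics of
union-sumsets (Ahlswede–Daykin). What prior routes do not do: GroupTheoreticSTPP needs abelian
groups of unbounded exponent and has
neither construction nor obstruction there; this line opens a host class with no exponent at all,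
whose first question
(crux IdempotentVolumeBeat: can a semilattice certify ω < 3?) is finite, decidable in small cases,
and new. Negatives index: empty.

RANKED CRUXES. #0 Thesis (target) — X_M as in § Thesis — for every ε > 0 a finite commutative monoid
with all elements regular and a monoid-TPP family (iff-form, indexed exactly like matMulDirectSum: z
= (i,(s,u)), x = (i,(s,t)), y = (i,(t,u))) with |M| < Σ_i (a_i b_i c_i)^((2+ε)/3). (why it might
fail: May be false: no monoid-TPP family beating even VOLUME (exponent 1) is known in any non-group
host; for the group part BCCGNSU Thm B and Pratt2024-type obstructions apply verbatim; border rank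
caps every leg's fill at 1/2 (LandsbergOttaviani2015), so n → ∞ at bounded fill is forced.)
[CohnKleinbergSzegedyUmans2005, CohnUmans2003, BlasiakChurchCohnGrochowNaslundSawinUmans2017,
arXiv:1810.08671, Solomon1967, Steinberg2016, LandsbergOttaviani2015]
#2 IdempotentVolumeBeat (crux) — some finite semilattice host (commutative monoid with x·x = x)
carries a monoid-TPP family with Σ_i a_i b_i c_i > |M| — equivalently (given SemilatticeRank +
TPPRestriction + the τ-theorem) a semilattice certifies ω < 3. Necessary for IdempotentPacking (ε =
1/2 already forces it; proved in Sketch.lean). Card items K-construction / Fastest refutation (i),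
corrected from exponent 2/3 (always true by AM-GM + injectivity) to exponent 1. [difficulty: M] (why
it might fail: V ≤ |L| may be a theorem: chains force b_i = 1; 2^[2] has max volume 4 = |L|; product
and common-core designs are provably sub-threshold (C(2d,d) < 4^d); a ⟨2,2,2⟩ block in 2^[4] poisons
every set meeting its core; all non-matching unions α∪β must fit in the host.)
[CohnKleinbergSzegedyUmans2005, Bollobas1965, Solomon1967, arXiv:1810.08671,
AlmanVassilevskaWilliams2018]
#3 BooleanObstruction (crux) — NEGATIVE, staffed: the Boolean lattices (2^[m], ∪) = powers of the
2-element semilattice are uniformly obstructed — one ε > 0 such that every monoid-TPP family of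
finite sets α, β, γ ⊆ Fin m (union as product) has Σ_i (a_i b_i c_i)^((2+ε)/3) ≤ 2^m for all m. The
analogue of BCCGNSU Thm B for the smallest idempotent host; it would be the first Solar-method
limitation for a tensor with Ĩ = R̃ (outside the reach of arXiv:1810.08671 Thm 4.1). Its refutation
is ω = 2. [difficulty: L] (why it might fail: No tool: slice rank of T_OR^⊗m is full, Ĩ(T_OR) = R̃ =
2, support functionals are maximal, AVW Thm 5.2 marginals are satisfiable (p(000) = p(111) = 1/2);
mesoscopic middle-layer packings (blocks 2^O(√m log m), fill 1/2) pass every count in NOTES M7/M10.)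
[BlasiakChurchCohnGrochowNaslundSawinUmans2017, arXiv:1810.08671, Sawin2018, Alman2021]
#4 IdempotentPacking (crux) — the thesis inside PURE semilattices: for every ε > 0 a finite
commutative idempotent monoid (= a union-closed set family with ∅, by x ↦ non-upper-bounds) with a
monoid-TPP family and |M| < Σ_i (a_i b_i c_i)^((2+ε)/3). Implies Thesis (proved in Sketch.lean); the
semilattice form of CKSU Conj 4.7: N ≈ |M|/(2n²) blocks of side n → ∞ at fill bounded below, cores
K_i with Bollobás systems inside and cross-unions pushed off the γ-layer. [deps:
IdempotentVolumeBeat] [difficulty: open-problem] (why it might fail: Sphere packing in J(m,m/2)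
forces dense core families to have many pairs at Johnson distance ≤ ξ+η+2δ, each spraying
cross-unions of every size over the γ-layer (NOTES M7); distance-avoidance costs m^(-2δ) while b =
C(2δ,δ) must balance a ≈ c; V ≤ |L| (¬rank 2) kills it.) [CohnKleinbergSzegedyUmans2005,
BlasiakChurchCohnGrochowNaslundSawinUmans2017, Bollobas1965, LandsbergOttaviani2015,
arXiv:1810.08671]
#9 TPPRestriction (support) — a monoid-TPP family in ANY finite monoid is a restriction
matMulDirectSum ℂ a b c ≤ groupTensor ℂ M (the 0/1 matrices of α, β, γ; CohnUmans2003 Thm 2.3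
without inverses — the iff-form needs no injectivity). [difficulty: provable-now] [CohnUmans2003,
Blaser2013, lean:Literature.Computability.AlgebraicComplexity.RealizesTPP.tensorRestrictsTo]
#9 RegularMonoidRank (support) — for a finite commutative monoid with every element regular
(Clifford monoid), ℂ[M] ≅ ⊕_e ℂ[G_e] ≅ ℂ^|M| (Munn–Ponizovskii; Steinberg2016 Ch. 9), hence
tensorRank (groupTensor ℂ M) ≤ |M| by structureTensor_restrictsTo_of_algEquiv and the block basis.
[difficulty: L] [Steinberg2016, Solomon1967,
lean:Literature.Computability.AlgebraicComplexity.structureTensor_restrictsTo_of_algEquiv,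
lean:Literature.Computability.AlgebraicComplexity.structureTensor_blockBasis_eq_matMulDirectSum]
#9 SemilatticeRank (support) — the idempotent case, explicit over any field: with x ≤ w ⟺ x·w = w
and μ the Moebius function of (M, ≤), [x·y = z] = Σ_w [x ≤ w][y ≤ w] μ(w,z)[w ≤ z] — |M| triads
(Solomon1967; Mathlib IncidenceAlgebra). [difficulty: M] [Solomon1967, Steinberg2016]

TWO-LAYER PLAN. Foreseen glued splits (none filed now): IdempotentPacking ⇐ BooleanMesoscopicDesign
(a concrete core-code + Bollobás + layer design in
2^[m] with fill ≥ c and n → ∞) → IdempotentPacking; or IdempotentPacking ⇐ UnionClosedHost (packings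
whose images generate a union-closed
family of size < Σ (abc)^((2+ε)/3)) → IdempotentPacking (the x ↦ non-upper-bounds embedding makes
these equivalent). IdempotentVolumeBeat ⇐
SmallHostSearch (|M| ≤ 32, SAT/IP certificate, kernel-checked by decide) → IdempotentVolumeBeat.
RegularMonoidRank ⇐ SemilatticeRank →
CliffordDecomposition (ℂ[M] ≅ ⊕_e ℂ[G_e]) → RegularMonoidRank.

KILL CRITERIA. ¬IdempotentVolumeBeat proved (V ≤ |L| for every finite semilattice) kills the
idempotent line outright: pure semilattices certify nothing
below 3, mixed Clifford hosts then reduce to STPP synergy inside group components (NOTES M8) and the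
route is closed
`superseded --by route-MatrixMultiplication-GroupTheoreticSTPP` (or `refuted:IdempotentVolumeBeat`).
BooleanObstruction proved does NOT
close the route (other union-closed hosts remain) but demotes it; BooleanObstruction refuted is ω =
2. CAbelianObstructionNeg of
GroupTheoreticSTPP proved + ¬IdempotentPacking proved ⇒ close refuted. X_C proved elsewhere moots
the route (X_C ⇒ X_M).

NOT DECOMPOSED YET. Mixed Clifford hosts (semilattice of nontrivial abelian groups: order-separation
across components is free but yields no volume gain by
itself, NOTES M8) — deferred until rank 2 is settled; the q-analogue (subspace lattices, skew
Bollobás systems) and partition lattices as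
hosts; the transfer statement "monoid-TPP in M ⇒ STPP in ⊕_e G_e or in E(M) with equal packing"
(card refutation iii); any use of
non-commutative inverse monoids (that is card rees-munn-monomial-algebras, Wedderburn blocks > 1);
definitions IsMonoidTPP / coreOf as
named Literature predicates (inlined for now).

CHEAPEST FALSIFIER. Exhaustive / SAT search for IdempotentVolumeBeat in the smallest hosts: all
union-closed families (equivalently all semilattices) with
|M| ≤ 16, block shapes with min(a,b,c) ≥ 2 (only these can gain: Σ(abc)^(2/3) ≤ |M| always), first
target two ⟨2,2,2⟩ blocks + one
⟨1,1,1⟩ in a 16-element host or two ⟨2,2,2⟩ in a 12–15-element host. By hand (NOTES M6): 2^[1]: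
V_max = 1; 2^[2]: V_max = 4 = |M|;
one ⟨2,2,2⟩ in 2^[4] leaves room for volume ≤ 4 more (poisoning), V ≤ 12 < 16. Not run on kit in
this one-shot session (left to the
rank-2 seat). Second: an Ahlswede–Daykin / LYM proof of V ≤ |L| on one page would retire the card.

NUMBERS. Trivial bounds (all hosts): Σ a_i b_i, Σ b_i c_i, Σ a_i c_i ≤ |M|, hence Σ (a_i b_i
c_i)^(2/3) ≤ |M| (AM-GM); single Boolean block abc ≤ 2^m
(a·c ≤ 2^(m−|K|), b ≤ 2^|K|). A finite family gives ω ≤ 3τ with Σ (a_i b_i c_i)^τ = |M|: nontrivial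
iff volume > |M|. Fill cap: N cubes
⟨n,n,n⟩ need N(2n²−n) ≤ |M| (Koszul-flattening border rank, additive), so γ-fill ≤ 1/2 + o(1); ω ≤ 2
+ log(1/fill)/log n. In 2^[m] at
fill 2^(−o(m)) almost every hit triple has x, y, z within O(√m) (AVW Thm 5.2 marginals: p(011) =
p(101) → 0), so blocks are
2^O(√m log m). Ĩ(T_OR) = 2 = R̃ (middle layer, C(m,m/2)); every group: Ĩ(T_G) < |G|. Abelian-group
record for comparison: ω < 2.41
(CKSU). Items at open: 8.

DEFINITION REQUESTS. None now (monoid-TPP is inlined in matMulDirectSum's own index convention).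
Later hygiene: `IsMonoidTPP` (Literature/Combinatorics or
AlgebraicComplexity) and the core/Bollobás block-structure lemma as a Literature theorem; cite-fact
wanted: Munn–Ponizovskii /
Steinberg2016 Ch. 9 decomposition of ℂ[M] for finite inverse monoids (would turn RegularMonoidRank
into a one-liner).

Novelty: Searches (2026-08-15): `lit frontier MatrixMultiplication --since 2021` (30 rows: asymptotic
spectrum, border subrank, catalogues — no
monoid hosts); `lit bridges MatrixMultiplication --cross any`; `lit search --hybrid "semigroup
algebra structure tensor matrix multiplication
exponent semilattice"` (8 books, semigroup textbooks only); `lit search --source zbmath "semigroup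
algebra fast matrix multiplication"` (1
irrelevant); `lit search --source crossref "matrix multiplication semilattice Moebius inversion
tensor rank"` (9, none relevant); `lit read
arxiv:1207.6528 --grep semigroup|monoid|lattice` (0 hits); `lit read arxiv:1810.08671` (Thm 4.1, Thm
5.2, Cor 5.1, Cor 6.1, Thm 6.1 read);
`lit read arxiv:1601.00292` (§5, Thm 5.2 read); arXiv/OpenAlex/S2 remote APIs rate-limited (429)
this session; galaxy queue saturated
(> 90 s) twice; the card's own searches (galaxy "triple product property" --star all, 13 rows;
coherent-configuration citers, 8 rows) stand.
Nearest prior art found: AlmanVassilevskaWilliams2018 = arXiv:1810.08671 (Solar/Galactic method on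
arbitrary tensors; group tensors
barred by Ĩ < |G|); YeLim2016 Thm 5.2 (linear realisation of any bilinear map in the diagonal
algebra k^r, declared tautological);
CohnUmans2013 = arXiv:1207.6528 (hosts = coherent configurations); arXiv:2410.14905 (infinite-group
hosts); Solomon1967 / Steinberg2016
(the diagonalisation); BlasiakChurchCohnGrochowNaslundSawinUmans2017 (the group-side barrier whose
engine does not transfer).
Delta  [refs: 1207.6528, 1810.08671, 1601.00292, 2410.14905, arxiv:1207.6528, arxiv:1810.08671, arxiv:1601.00292, AlmanVassilevskaWilliams2018, YeLim2016, CohnUmans2013, Solomon1967, Steinberg2016, BlasiakChurchCohnGrochowNaslundSawinUmans2017]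

Barriers (technique_class: group-theoretic-approach, STPP, monoid-host, solar-method): - technique_class: group-theoretic-approach, STPP, monoid-host, solar-method
- Literature.Barriers.MatrixMultiplication.TricoloredSumFreeBarrier: stated and proved for STPP in
abelian GROUPS of bounded exponent (Thm A ⇒ Thm B); the engine (packing ⇒ large tricolored matching
⇒ slice-rank cap) transfers formally to monoids but its last step is void here: slice rank of T_M is
full and Ĩ(T_OR) = 2 (the matching question the card left open is settled by the middle layer), so
it does not apply to the idempotent part; for group components G_e of a Clifford host it applies
verbatim (not_beats_of_exponent_le) — they must be trivial, small, or of unbounded exponent.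
- Literature.Barriers.MatrixMultiplication.UniversalMethodBarrier: Alman2021's bounds ω_u(T) > 2
need S̃(T) < R̃(T) (Thm 2.7 / Cor 2.8); for T_M ≅ ⟨|M|⟩ asymptotic slice rank equals asymptotic
rank, so the catalogue entry gives exactly ω_u ≥ 2 — evaded by mechanism (diagonal host), at the
price that all content moves into the combinatorics of the basis.
- Literature.Barriers.MatrixMultiplication.InfimumNotMinimumBarrier: respected — X_M asks for a
family of hosts as ε → 0, never one algorithm; each finite family certifies only ω ≤ 3τ < its own
target (CoppersmithWinograd1982_strictASI), consistent with rank-2 being a strict volume inequality.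
- Literature.Barriers.MatrixMultiplication.EquivoluminousBarrier: CW90 §11 / USP-type local
hypotheses in bounded-exponent groups fall to sunflower bounds (NaslundSawin2017_thm3); our

Novelty grade: new-combination — refuter route-review grade. Nearest prior art: Cohn–Umans 2013 arXiv:1207.6528 §4.1 Def 'A realizes ⟨ℓ,m,n⟩' (strict realization of matrix multiplication in an algebra with a distinguished basis via injective α, β, γ and an iff on structure constants) + Props 9–10 — the MECHANISM of this route is ex (refuter refuter-rreview-route-MatrixMultiplicati-95e7b4aa-0, 2026-08-15T14:12:28Z; prior: arxiv:1207.6528, CohnKleinbergSzegedyUmans2005, CohnUmans2003, Solomon1967, Steinberg2016, arxiv:1810.08671, Bollobas1965, BlasiakChurchCohnGrochowNaslundSawinUmans2017)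

History (route lifecycle, newest last):
- 2026-08-16T04:11:19Z · AUTO-CRUX (backfill): Thesis — hypotheses of the deciding theorem that nothing in the route derives are cruxes (operator:999:1085951)
- 2026-08-26T12:04:41Z · DORMANT — reconciler: no traction for 8.3 d (last activity item-evidence-added at 2026-08-18T04:21:54Z); parked, not closed — `ledger route dormant route-MatrixMultiplica (operator:999:3878633)

sub-problem: MatrixMultiplication · status: dormant · opened planner-plancard-MatrixMultiplication-MatrixM-f3d5baea-0 2026-08-15T11:43:41Z · rev 1 · ledger route-MatrixMultiplication-SemilatticeSTPP
GENERATED by the gate from the ledger (D-0016/17). Provers cite these decls: `theorem foo : Summit.MatrixMultiplication.MatrixMultiplication.Theses.SemilatticeSTPP.<Decl> := …` in Summits/MatrixMultiplication/MatrixMultiplication/Theorems/<Name>.lean.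
-/

namespace Summit.MatrixMultiplication.MatrixMultiplication.Theses.SemilatticeSTPP

open scoped BigOperators Topology Manifold Classical MeasureTheory ProbabilityTheory Matrix InnerProductSpace ComplexConjugate ContinuousMap
open Filter Set Function TopologicalSpace MeasureTheory

attribute [summit_statement] _root_.MatrixMultiplication

/-- item stmt-MatrixMultiplication-5969 · crux (kind.auto-crux: conjecture-grade) · rank 0 · open · by planner
why it might fail: May be false: no monoid-TPP family beating even VOLUME (exponent 1) is known in any non-group host; for the group part BCCGNSU Thm B and Pratt2024-type obstructions apply verbatim; border rank caps every leg's fill at 1/2 (LandsbergOttaviani2015), so n → ∞ at bounded fill is forced.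
sources: CohnKleinbergSzegedyUmans2005, CohnUmans2003, BlasiakChurchCohnGrochowNaslundSawinUmans2017, arXiv:1810.08671, Solomon1967, Steinberg2016
[target] X_M as in § Thesis — for every ε > 0 a finite commutative monoid with all elements regular
and a monoid-TPP family (iff-form, indexed exactly like matMulDirectSum: z = (i,(s,u)), x =
(i,(s,t)), y = (i,(t,u))) with |M| < Σ_i (a_i b_i c_i)^((2+ε)/3). -/
@[route_item "route-MatrixMultiplication-SemilatticeSTPP", crux]
def Thesis : Prop :=
  ∀ ε : ℝ, 0 < ε → ∃ (M : Type) (_ : CommMonoid M) (_ : Fintype M), (∀ x : M, ∃ y : M, x * y * x = x) ∧ ∃ (p : ℕ) (a b c : Fin p → ℕ) (α : (Σ i, Fin (a i) × Fin (b i)) → M) (β : (Σ i, Fin (b i) × Fin (c i)) → M) (γ : (Σ i, Fin (a i) × Fin (c i)) → M), (∀ x y z, α x * β y = γ z ↔ (z.1 = x.1 ∧ x.1 = y.1 ∧ (z.2.1 : ℕ) = x.2.1 ∧ (x.2.2 : ℕ) = y.2.1 ∧ (z.2.2 : ℕ) = y.2.2)) ∧ (Fintype.card M : ℝ) < ∑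 i, ((a i * b i * c i : ℕ) : ℝ) ^ ((2 + ε) / 3)

/-- item stmt-MatrixMultiplication-5970 · crux · rank 2 · open · by planner
why it might fail: V ≤ |L| may be a theorem: chains force b_i = 1; 2^[2] has max volume 4 = |L|; product and common-core designs are provably sub-threshold (C(2d,d) < 4^d); a ⟨2,2,2⟩ block in 2^[4] poisons every set meeting its core; all non-matching unions α∪β must fit in the host.
sources: CohnKleinbergSzegedyUmans2005, Bollobas1965, Solomon1967, arXiv:1810.08671, AlmanVassilevskaWilliams2018
[crux] some finite semilattice host (commutative monoid with x·x = x) carries a monoid-TPP family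
with Σ_i a_i b_i c_i > |M| — equivalently (given SemilatticeRank + TPPRestriction + the τ-theorem) a
semilattice certifies ω < 3. Necessary for IdempotentPacking (ε = 1/2 already forces it; proved in
Sketch.lean). Card items K-construction / Fastest refutation (i), corrected from exponent 2/3
(always true by AM-GM + injectivity) to exponent 1. [difficulty: M] -/
@[route_item "route-MatrixMultiplication-SemilatticeSTPP"]
def IdempotentVolumeBeat : Prop :=
  ∃ (M : Type) (_ : CommMonoid M) (_ : Fintype M), (∀ x : M, x * x = x) ∧ ∃ (p : ℕ) (a b c : Fin p → ℕ) (α : (Σ i, Fin (a i) × Fin (b i)) → M) (β : (Σ i, Fin (b i) × Fin (c i)) → M) (γ : (Σ i, Fin (a i) × Fin (c i)) → M), (∀ x y z, α x * β y = γ z ↔ (z.1 = x.1 ∧ x.1 = y.1 ∧ (z.2.1 : ℕ) = x.2.1 ∧ (x.2.2 : ℕ) = y.2.1 ∧ (z.2.2 : ℕ) = y.2.2)) ∧ Fintype.card M < ∑ i, a i * b i * c i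

/-- item stmt-MatrixMultiplication-5971 · crux · rank 3 · open · by planner
why it might fail: No tool: slice rank of T_OR^⊗m is full, Ĩ(T_OR) = R̃ = 2, support functionals are maximal, AVW Thm 5.2 marginals are satisfiable (p(000) = p(111) = 1/2); mesoscopic middle-layer packings (blocks 2^O(√m log m), fill 1/2) pass every count in NOTES M7/M10.
sources: BlasiakChurchCohnGrochowNaslundSawinUmans2017, arXiv:1810.08671, Sawin2018, Alman2021
[crux] NEGATIVE, staffed: the Boolean lattices (2^[m], ∪) = powers of the 2-element semilattice are
uniformly obstructed — one ε > 0 such that every monoid-TPP family of finite sets α, β, γ ⊆ Fin m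
(union as product) has Σ_i (a_i b_i c_i)^((2+ε)/3) ≤ 2^m for all m. The analogue of BCCGNSU Thm B
for the smallest idempotent host; it would be the first Solar-method limitation for a tensor with Ĩ
= R̃ (outside the reach of arXiv:1810.08671 Thm 4.1). Its refutation is ω = 2. [difficulty: L] -/
@[route_item "route-MatrixMultiplication-SemilatticeSTPP"]
def BooleanObstruction : Prop :=
  ∃ ε : ℝ, 0 < ε ∧ ∀ (m p : ℕ) (a b c : Fin p → ℕ) (α : (Σ i, Fin (a i) × Fin (b i)) → Finset (Fin m)) (β : (Σ i, Fin (b i) × Fin (c i)) → Finset (Fin m)) (γ : (Σ i, Fin (a i) × Fin (c i)) → Finset (Fin m)), (∀ x y z, α x ∪ β y = γ z ↔ (z.1 = x.1 ∧ x.1 = y.1 ∧ (z.2.1 : ℕ) = x.2.1 ∧ (x.2.2 : ℕ) = y.2.1 ∧ (z.2.2 : ℕ) = y.2.2)) → ∑ i, ((a i * b i * c i : ℕ) : ℝ) ^ ((2 + ε) / 3) ≤ (2 : ℝ) ^ m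

/-- item stmt-MatrixMultiplication-5972 · crux · rank 4 · open · by planner
why it might fail: Sphere packing in J(m,m/2) forces dense core families to have many pairs at Johnson distance ≤ ξ+η+2δ, each spraying cross-unions of every size over the γ-layer (NOTES M7); distance-avoidance costs m^(-2δ) while b = C(2δ,δ) must balance a ≈ c; V ≤ |L| (¬rank 2) kills it.
sources: CohnKleinbergSzegedyUmans2005, BlasiakChurchCohnGrochowNaslundSawinUmans2017, Bollobas1965, LandsbergOttaviani2015, arXiv:1810.08671
[crux] the thesis inside PURE semilattices: for every ε > 0 a finite commutative idempotent monoid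
(= a union-closed set family with ∅, by x ↦ non-upper-bounds) with a monoid-TPP family and |M| < Σ_i
(a_i b_i c_i)^((2+ε)/3). Implies Thesis (proved in Sketch.lean); the semilattice form of CKSU Conj
4.7: N ≈ |M|/(2n²) blocks of side n → ∞ at fill bounded below, cores K_i with Bollobás systems
inside and cross-unions pushed off the γ-layer. [deps: IdempotentVolumeBeat] [difficulty:
open-problem] -/
@[route_item "route-MatrixMultiplication-SemilatticeSTPP", crux]
def IdempotentPacking : Prop :=
  ∀ ε : ℝ, 0 < ε → ∃ (M : Type) (_ : CommMonoid M) (_ : Fintype M), (∀ x : M, x * x = x) ∧ ∃ (p : ℕ) (a b c : Fin p → ℕ) (α : (Σ i, Fin (a i) × Fin (b i)) → M) (β : (Σ i, Fin (b i) × Fin (c i)) → M) (γ : (Σ i, Fin (a i) × Fin (c i)) → M), (∀ x y z, α x * β y = γ z ↔ (z.1 = x.1 ∧ x.1 = y.1 ∧ (z.2.1 : ℕ) = x.2.1 ∧ (x.2.2 : ℕ) = y.2.1 ∧ (z.2.2 : ℕ) = y.2.2)) ∧ (Fintype.card M : ℝ) < ∑ i, ((a i * b i * c i : ℕ) : ℝ)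 ^ ((2 + ε) / 3)

/-- item stmt-MatrixMultiplication-5973 · support · rank 9 · closed · proved by Summit.MatrixMultiplication.MatrixMultiplication.Theorems.TPPRestriction_proof @ d87eea47b023 (prover) · by planner
sources: CohnUmans2003, Blaser2013, lean:Literature.Computability.AlgebraicComplexity.RealizesTPP.tensorRestrictsTo
[support] a monoid-TPP family in ANY finite monoid is a restriction matMulDirectSum ℂ a b c ≤
groupTensor ℂ M (the 0/1 matrices of α, β, γ; CohnUmans2003 Thm 2.3 without inverses — the iff-form
needs no injectivity). [difficulty: provable-now] -/
@[route_item "route-MatrixMultiplication-SemilatticeSTPP", crux]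
def TPPRestriction : Prop :=
  ∀ (M : Type) [Monoid M] [Fintype M] [DecidableEq M] (p : ℕ) (a b c : Fin p → ℕ) (α : (Σ i, Fin (a i) × Fin (b i)) → M) (β : (Σ i, Fin (b i) × Fin (c i)) → M) (γ : (Σ i, Fin (a i) × Fin (c i)) → M), (∀ x y z, α x * β y = γ z ↔ (z.1 = x.1 ∧ x.1 = y.1 ∧ (z.2.1 : ℕ) = x.2.1 ∧ (x.2.2 : ℕ) = y.2.1 ∧ (z.2.2 : ℕ) = y.2.2)) → Literature.Computability.AlgebraicComplexity.TensorRestrictsTo (Literature.Computability.AlgebraicComplexity.groupTensor ℂ M) (Literature.Computability.AlgebraicComplexity.matMulDirectSum ℂ a b c)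

-- `TPPRestriction` holds: proved by `Summit.MatrixMultiplication.MatrixMultiplication.Theorems.TPPRestriction_proof` @ d87eea47b023 (its module imports this route file, so no `_holds` link can be stated here).

/-- item stmt-MatrixMultiplication-5974 · support · rank 9 · closed · proved by Summit.MatrixMultiplication.MatrixMultiplication.Theorems.regularMonoidRank_proof @ 080e58746066 (prover) · by planner
sources: Steinberg2016, Solomon1967, lean:Literature.Computability.AlgebraicComplexity.structureTensor_restrictsTo_of_algEquiv, lean:Literature.Computability.AlgebraicComplexity.structureTensor_blockBasis_eq_matMulDirectSum
[support] for a finite commutative monoid with every element regular (Clifford monoid), ℂ[M] ≅ ⊕_e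
ℂ[G_e] ≅ ℂ^|M| (Munn–Ponizovskii; Steinberg2016 Ch. 9), hence tensorRank (groupTensor ℂ M) ≤ |M| by
structureTensor_restrictsTo_of_algEquiv and the block basis. [difficulty: L] -/
@[route_item "route-MatrixMultiplication-SemilatticeSTPP", crux]
def RegularMonoidRank : Prop :=
  ∀ (M : Type) [CommMonoid M] [Fintype M] [DecidableEq M], (∀ x : M, ∃ y : M, x * y * x = x) → Literature.Computability.AlgebraicComplexity.tensorRank (Literature.Computability.AlgebraicComplexity.groupTensor ℂ M) ≤ Fintype.card M

-- `RegularMonoidRank` holds: proved by `Summit.MatrixMultiplication.MatrixMultiplication.Theorems.regularMonoidRank_proof` @ 080e58746066 (its module imports this route file, so no `_holds` link can be stated here).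

/-- item stmt-MatrixMultiplication-5975 · support · rank 9 · closed · proved by Summit.MatrixMultiplication.MatrixMultiplication.Theorems.SemilatticeRank_proof @ 141c5e4fb5a7 (prover) · by planner
sources: Solomon1967, Steinberg2016
[support] the idempotent case, explicit over any field: with x ≤ w ⟺ x·w = w and μ the Moebius
function of (M, ≤), [x·y = z] = Σ_w [x ≤ w][y ≤ w] μ(w,z)[w ≤ z] — |M| triads (Solomon1967; Mathlib
IncidenceAlgebra). [difficulty: M] -/
@[route_item "route-MatrixMultiplication-SemilatticeSTPP"]
def SemilatticeRank : Prop :=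
  ∀ (M : Type) [CommMonoid M] [Fintype M] [DecidableEq M], (∀ x : M, x * x = x) → Literature.Computability.AlgebraicComplexity.tensorRank (Literature.Computability.AlgebraicComplexity.groupTensor ℂ M) ≤ Fintype.card M

-- `SemilatticeRank` holds: proved by `Summit.MatrixMultiplication.MatrixMultiplication.Theorems.SemilatticeRank_proof` @ 141c5e4fb5a7 (its module imports this route file, so no `_holds` link can be stated here).

/-- item stmt-MatrixMultiplication-5976 · assembly · rank 1 · closed · proved by Summit.MatrixMultiplication.MatrixMultiplication.Theorems.semilatticeSTPP_assembly_proof @ 802a335d2f73 (prover) · by planner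
sources: Blaser2013, Schonhage1981, CohnUmans2003
[assembly] TPPRestriction → RegularMonoidRank → Thesis → ω(ℂ) = 2. -/
@[route_item "route-MatrixMultiplication-SemilatticeSTPP"]
def Assembly : Prop :=
  TPPRestriction → RegularMonoidRank → Thesis → MatrixMultiplication

-- `Assembly` holds: proved by `Summit.MatrixMultiplication.MatrixMultiplication.Theorems.semilatticeSTPP_assembly_proof` @ 802a335d2f73 (its module imports this route file, so no `_holds` link can be stated here).

/-! D-0027 §2.1 — DECIDING THEOREM (planner-authored via `route open/edit --closes-file`; by planner-rbadge-MatrixMultiplication-Semilattic-ca96844a-g2-0 2026-08-15T16:15:19Z):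
its hypotheses are this route's items and its conclusion the sub-problem Statement (glue_lint), and it elaborates with this file. -/

/-- DECIDING THEOREM (D-0027 §2.1): a monoid-TPP restriction lemma (`TPPRestriction`), the rank
bound `R(T_M) ≤ |M|` for Clifford (all-elements-regular commutative) monoids (`RegularMonoidRank`)
and the packing thesis `Thesis` (X_M) decide `ω(ℂ) = 2`: if `ω(ℂ) ≠ 2` then `ω(ℂ) > 2`
(`omega_two_le`); take `ε := ω(ℂ) − 2 > 0` in `Thesis` to get a host `M` and a monoid-TPP family
with `|M| < Σ (aᵢbᵢcᵢ)^((2+ε)/3) = Σ (aᵢbᵢcᵢ)^(ω/3)`; `TPPRestriction` gives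
`⊕⟨aᵢ,bᵢ,cᵢ⟩ ≤ T_M`, so `R(⊕⟨aᵢ,bᵢ,cᵢ⟩) ≤ R(T_M) ≤ |M|` (`TensorRestrictsTo.tensorRank_le`,
`RegularMonoidRank`), and Schönhage's asymptotic sum inequality for the rank (PROVED in tree,
`asymptoticSumInequality_rank`, Bläser 2013 Thm 7.5) gives `Σ (aᵢbᵢcᵢ)^(ω/3) ≤ |M|` —
contradiction. -/
@[closes "route-MatrixMultiplication-SemilatticeSTPP"] theorem closes (hT : TPPRestriction) (hR : RegularMonoidRank) (hX : Thesis) :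
    MatrixMultiplication := by
  show Literature.Computability.AlgebraicComplexity.omega ℂ = 2
  by_contra hne
  have h2 : (2 : ℝ) ≤ Literature.Computability.AlgebraicComplexity.omega ℂ :=
    Literature.Computability.AlgebraicComplexity.omega_two_le ℂ
  have hgt : (2 : ℝ) < Literature.Computability.AlgebraicComplexity.omega ℂ :=
    lt_of_le_of_ne h2 (Ne.symm hne)
  obtain ⟨M, instM, instF, hreg, p, a, b, c, α, β, γ, htpp, hcard⟩ :=
    hX (Literature.Computability.AlgebraicComplexity.omega ℂ - 2) (by linarith)
  classical
  have hres := hT M p a b c α β γ htpp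
  have hrank : Literature.Computability.AlgebraicComplexity.tensorRank
      (Literature.Computability.AlgebraicComplexity.matMulDirectSum ℂ a b c) ≤ Fintype.card M :=
    hres.tensorRank_le.trans (hR M hreg)
  have hasi :=
    Literature.Computability.AlgebraicComplexity.asymptoticSumInequality_rank ℂ a b c hrank
  have hexp : (2 + (Literature.Computability.AlgebraicComplexity.omega ℂ - 2)) / 3 =
      Literature.Computability.AlgebraicComplexity.omega ℂ / 3 := by ring
  rw [hexp] at hcard
  linarith

end Summit.MatrixMultiplication.MatrixMultiplication.Theses.SemilatticeSTPP
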